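import Literature.AlgebraicGeometry.Deligne1982.CMHodgeStructuresRealisedOnProducts
import Literature.AlgebraicGeometry.ComplexMultiplication.CMAbelianVarietyRealisedHolds
import HarnessLib

/-!
# Every effective CM Hodge structure is realised on a product of CM abelian varieties —
# UNCONDITIONALLY (Abdulali 2005, Theorem 3; Deligne 1982, I §5 (c))

Family `hodge`, layer `Literature/AlgebraicGeometry/Deligne1982`; one theorem, no definition, no
named fact.  `Deligne1982/CMHodgeStructuresRealisedOnProducts` proves Abdulali's Theorem 3 on the
tree's carriers («Let `V` be an effective Hodge structure with complex multiplication by `E`. Then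
`V` is isomorphic to a Hodge substructure of the cohomology of a product of abelian varieties with
CM by `E`», held `paper:arxiv-math_0601052` chunks p0005–p0006; Deligne LNM 900 I §5 (c): the
`E`-diagonal lines `⊗_i H¹(A_i)_s` of `Hⁿ(⊕_i A_{Φ_i})` have Hodge type `(a_s, a_{ιs})`) in two steps:
`exists_cmTypes_realising` (for EVERY family of realisations of suitable CM types `T_0, …, T_{n−1}`
the `s`-diagonal weight spaces are lines of the prescribed Hodge types) and the closed form
`exists_realisation_of_cmAbelianVarietyRealised (h₃ : PicardCM.CMAbelianVarietyRealised) …`, which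
takes the realisations from the record `PicardCM.CMAbelianVarietyRealised` (Shimura 1998 §6.2
Thm. 3) carried as a HYPOTHESIS.  That record is now the Literature theorem
`PicardCM.CMAbelianVarietyRealised_holds` (`ComplexMultiplication/CMAbelianVarietyRealisedHolds`:
Thm. 4's Riemann form, Lefschetz, GAGA descent), so the closed form holds outright:

* `exists_realisation_of_effectiveTypeFunction` — for a CM field `K`, every `n` and every type function `φ : Hom(K, ℂ) → ℕ`
  with `φ(s) + φ(s̄) = n` («effective Hodge structure of CM-type» `V_φ`, Abdulali Lemma 2), there
  are CM types `T_i` and realisations `(A_i, ι_i, θ_i)` of the `(K; T_i)`, `dim A_i = [K:ℚ]/2`, such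
  that for every embedding `s` the product `⨁_i A_i` carries a NON-ZERO class `c_s ∈ Hⁿ((⨁ A_i)(ℂ); ℂ)`
  on which the diagonal `a ∈ 𝓞_K` acts by `s(a)ⁿ`, of Hodge type `(φ(s), φ(s̄))`, spanning the
  `s`-diagonal weight space — «any effective Hodge structure of CM-type occurs (without having to
  take a Tate twist) in the cohomology of some CM abelian variety over `ℂ`» (Abstract).

## References

* [Abdulali2005CMHodge] S. Abdulali, *Hodge structures of CM-type*, J. Ramanujan Math. Soc. 20
  (2005) 155–162 = arXiv:math/0601052: Abstract, Lemma 2, Theorem 3 with proof (held chunks p0001,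
  p0005–p0006).
* [Deligne1982HodgeCycles] P. Deligne (notes by J. S. Milne), *Hodge cycles on abelian varieties*,
  LNM 900 (1982), I §5 (c), re-ed. p. 38.
* [Shimura1998] G. Shimura, *Abelian Varieties with Complex Multiplication and Modular Functions*
  (1998), §6.2 Theorem 3 (pp. 41–42).

Provenance: lane `lit-hodgefound`, sequel of row A3-G4 (seat p21): the Literature re-home of the
realisation record makes this Layer-B statement hypothesis-free.
-/

noncomputable section

open CategoryTheory CategoryTheory.Limits NumberField

namespace Literature.AlgebraicGeometry.Deligne1982

open Literature.AlgebraicGeometry.Motives (AbelianVariety CMType)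
open Literature.AlgebraicGeometry.HodgeTheory
open Literature.AlgebraicGeometry.ComplexMultiplication (IsCMTypeRealisation)
open Literature.AlgebraicGeometry.Pohlmann1968
open Literature.NumberTheory.Automorphic (PicardCM.CMAbelianVarietyRealised_holds)

open scoped Classical

variable (K : Type) [Field K] [NumberField K] [IsCMField K]

/-- **Abdulali 2005, Theorem 3 / Deligne 1982, I §5 (c), UNCONDITIONALLY: every effective CM Hodge
structure `V_φ` of a CM field `K` is realised on a product of CM abelian varieties.**  For every
`n` and every `φ : Hom(K, ℂ) → ℕ` with `φ(s) + φ(s̄) = n` there are CM types `T_0, …, T_{n−1}` of `K`,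
abelian varieties `A_i/ℂ` of dimension `[K:ℚ]/2` with `𝓞_K`-actions `ι_i` realising the `(K; T_i)`
on `H¹`, such that for every embedding `s : K → ℂ` the product `B = ⨁_i A_i` carries a NON-ZERO
class `c_s ∈ Hⁿ(B(ℂ); ℂ)` on which the diagonal `a ∈ 𝓞_K` acts by `s(a)ⁿ`, of Hodge type
`(φ(s), φ(s̄))`, spanning the `s`-diagonal weight space («Inside the Künneth component … we have the
space `⊕_σ V^σ = V_ℂ`, so `H^{r+1}(A × B, ℚ)` contains a Hodge substructure isomorphic to `V`»).
The closed form `exists_realisation_of_cmAbelianVarietyRealised` at the Literature theorem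
`PicardCM.CMAbelianVarietyRealised_holds` (Shimura 1998 §6.2 Thm. 3: every CM type is realised).
[cite: Abdulali2005CMHodge, Abstract and Theorem 3 (held chunks p0001, p0005–p0006)]
[cite: Deligne1982HodgeCycles, §5 (p. 38, (c))] [cite: Shimura1998, §6.2 Theorem 3 (pp. 41–42)] -/
theorem exists_realisation_of_effectiveTypeFunction (n : ℕ) (φ : (K →+* ℂ) → ℕ)
    (hφ : ∀ s, φ s + φ (ComplexEmbedding.conjugate s) = n) :
    ∃ (T : Fin n → CMType K) (A : Fin n → AbelianVariety ℂ) (ι : ∀ i, 𝓞 K →+* End (A i))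
      (θ : ∀ i, K →+* Module.End ℂ (complexBetti (A i).X 1)),
      (∀ i, IsCMTypeRealisation (T i) (A i) (ι i) (θ i)) ∧ (∀ i, (A i).dim = Module.finrank ℚ K / 2) ∧
      ∀ s : K →+* ℂ, ∃ c : complexBetti (⨁ A).X n, c ≠ 0 ∧
        (∀ a : 𝓞 K, complexBetti.map (biproduct.map fun i => ι i a).hom.hom.hom n c = (s a) ^ n • c) ∧
        IsOfHodgeType (⨁ A).dim (⨁ A).X n (φ s) (φ (ComplexEmbedding.conjugate s)) c ∧
        ∀ c' ∈ weightClassesAlg (K := fun _ : Fin n => K) A ι n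
            (Finset.univ.map ⟨fun i : Fin n => (⟨i, s⟩ : (_ : Fin n) × (K →+* ℂ)),
              fun i j h => by simpa using congrArg Sigma.fst h⟩),
          ∃ t : ℂ, c' = t • c :=
  exists_realisation_of_cmAbelianVarietyRealised K PicardCM.CMAbelianVarietyRealised_holds n φ hφ

end Literature.AlgebraicGeometry.Deligne1982

end
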